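import Literature.IUT.LogThetaLattice.ThetaPilotObjectsFrakModel
import Literature.IUT.LogThetaLattice.ThetaPilotObjectsDivisorSignature
import Literature.IUT.LogThetaLattice.GlobalFrobenioidModelsCategory
import HarnessLib

/-!
# [IUTchIII] Proposition 3.7 (v) at the model of record, B: the output signature over the model of `𝓕⊛_𝔪𝔬𝔡` and
# the Θ-pilot object of Definition 3.8 (i) as the family of integral ideals `(𝔮̲_v^{j²})`
# (abc-iut cell, layer L6, §F row F10-c; sequel of `ThetaPilotObjectsFrakModel.lean`)

S. Mochizuki, *Inter-universal Teichmüller theory III*, kurims manuscript (May 2020), §3: Proposition 3.7 (v)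
p. 111 l. 68 – p. 112 l. 22 (the realified product embeddings `†𝒞^⊩_LGP ↪ Π_j (†𝓕⊛ℝ_MOD)_j`,
`†𝒞^⊩_lgp ↪ Π_j (†𝓕⊛ℝ_𝔪𝔬𝔡)_j` and "an algorithm for constructing … objects of the [global!] categories … from the local
fractional ideals generated by elements of the monoids `Ψ_{𝓕_lgp}(†𝓗𝓣^{Θ±ell}NF)_v` for `v ∈ 𝕍^bad`") and
Definition 3.8 (i) p. 112 l. 26–50: the **Θ-pilot object** is "the object of `Π_{j∈𝔽_l^⋇} (†𝓕⊛_MOD)_j` or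
`Π_{j∈𝔽_l^⋇} (†𝓕⊛_𝔪𝔬𝔡)_j` — as well as its realification, regarded as an object of `†𝒞^⊩_LGP` … or `†𝒞^⊩_lgp` … —
determined by any collection, indexed by `v ∈ 𝕍^bad`, of generators up to torsion of the monoids
`Ψ^⊥_{𝓕_lgp}(†𝓗𝓣^{Θ±ell}NF)_v`" [claim: Mochizuki2012, status: disputed] (own render `paper:url-4b091feeb646`
p0111–p0112).

WHAT THIS FILE ADDS (over abc-iut-L6-t4's Dupuy–Hilado `divisorSignatureRoot` and part A):
* `frakSignatureRoot X` — the `GlobalLGPFrobenioidSignature` of Prop. 3.7 over the MODEL OF RECORD of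
  `(†𝓕⊛_𝔪𝔬𝔡)_j` (abc-iut-L6-t4, -t6, -d1, -d3's `ModelFrakObj F`): objects of `(†𝓕⊛_*)_j` = `ModelFrakObj F`, objects of
  `†𝒞^⊩_LGP`, `†𝒞^⊩_lgp` = abc-iut-c312-3's `LgpDivisor F l⋆`, realified product EMBEDDINGS of (v) = part A's
  `ofLgpDivisor` (injective, NOT the identity), `objOfLgp = thetaObjOfRoot X` (abc-iut-L6-t4, root convention),
  `objOfFrak = objOfFrakModel X` (part A); the square of (v) COMMUTES on objects (`frakSignatureRoot_square`);
* **`thetaPilotObject (frakSignatureRoot X) (SplittingMonoids.dhRoot X ρ ζ) = X.thetaPilot`** and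
  `thetaPilotObject_wellDefined` HOLDS (via abc-iut-L6-t4's `…_of_factors_root`);
* **the `𝔪𝔬𝔡`-incarnation of the Θ-pilot object IS the family of integral ideals `(𝔮̲_v^{j²})_{v ∈ 𝕍^bad}`**:
  `thetaPilotObjectFrak (frakSignatureRoot X) … = thetaPilotFrakModel X ρ`, with `ℤ`-exponents
  `thetaPilotExponents X ρ j = Σ_{v ∈ 𝕍^bad} j²·ord_v(q̲_v)·[v]` whose realification is abc-iut-c312-3's theta-pilot
  divisor `P_{Θ,j}` (`realifyExponents_thetaPilotExponents`), INDEPENDENT of the generators chosen as an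
  equality of `ℤ`-divisors (`idealExponents_eq_thetaPilotExponents` — Def. 3.8 (i)'s "determined by any
  collection … of generators up to torsion" at the `ℤ`-level), NONNEGATIVE (`thetaPilotExponents_nonneg`),
  hence an EFFECTIVE element of abc-iut-L6-t6's divisor monoid `effDiv` of the model Frobenioid
  (`thetaPilotFrakModel_mem_effDiv`), of degree `frakDeg = −deĝ_F(P_{Θ,j}) < 0`, global log-volume
  `μ^log = −deĝ_F(P_{Θ,j})` ([IUTchIII] Prop. 3.9 (iii) through abc-iut-L6-d3's `globalLogVolume_frakRegion`),
  and procession average `−deĝ_lgp(P_Θ) = −((l⋆+1)(2l⋆+1)/6)·deĝ_F(P_q)` (abc-iut-c312-3's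
  `degLgp_thetaPilot`; the coefficient of [IUTchIV] Thm. 1.10, Step (v)).

HONEST FRAMING as in part A: a MODEL-LEVEL inhabitant (Frobenioids = objects of the Example 3.6 (ii) model,
strips = names, realification invisible on object classes at `Γ_v = ℝ`); the CATEGORY-level construction of
Prop. 3.7 and the compatibility with the `𝓕^⊩`-prime-strip's local isomorphisms `†ρ_{lgp,v}` remain the layer's
named residual. Nothing here asserts a disputed claim or takes a side on [IUTchIII] Cor. 3.12; typed ≠
discharged; instantiated ≠ endorsed.
-/

noncomputable section

namespace Literature.IUT.LogThetaLattice

open Literature.IUT.HodgeArakelov Literature.IUT.LogVolume NumberField IsDedekindDomain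
open Literature.IUT.LogThetaLattice.GlobalFrobenioidModels
open Literature.NumberTheory.EllipticCurves

section Reindex

variable {F : Type} [Field F] [NumberField F] (X : PilotData F)

/-- Re-indexing: a sum over `S.attach` of single-place divisors whose coefficients do not depend on the
membership proof is the corresponding sum over `S`. [folklore] -/
private theorem sum_attach_of_eq {c : ∀ v ∈ X.S, ℝ} {d : HeightOneSpectrum (𝓞 F) → ℝ}
    (h : ∀ v (hv : v ∈ X.S), c v hv = d v) :
    ∑ v ∈ X.S.attach, FinDivisor.of v.1 (c v.1 v.2) = ∑ v ∈ X.S, FinDivisor.of v (d v) := by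
  rw [← Finset.sum_attach X.S (fun v => FinDivisor.of v (d v))]
  exact Finset.sum_congr rfl fun v _ => by rw [h v.1 v.2]

end Reindex

section Dictionary

variable {F : Type} [Field F] [NumberField F]

/-- Dictionary with abc-iut-L6-d3's bijection `frakObjEquivADivisor : ModelFrakObj F ≃ ADiv_ℝ(F)`: part A's
embedding `ofFinDivisorFrak` is the section `D ↦ frakObjEquivADivisor⁻¹(−D)` of it (no second model of the
`𝓕⊛_𝔪𝔬𝔡`-objects is introduced). [claim: Mochizuki2012, status: disputed] -/
theorem ofFinDivisorFrak_eq_symm (D : FinDivisor F) :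
    ofFinDivisorFrak D = frakObjEquivADivisor.symm (-ADivisor.ofFinDivisor F D) := by
  apply frakObjEquivADivisor.injective
  rw [Equiv.apply_symm_apply, frakObjEquivADivisor_apply, frakDivisor_ofFinDivisorFrak]

end Dictionary

/-! ### §3 The signature of Prop. 3.7 at the model of `𝓕⊛_𝔪𝔬𝔡`, and its Θ-pilot object -/

section Signature

variable {F : Type} [Field F] [NumberField F] (X : PilotData F)

/-- The objects of the Frobenioids named by abc-iut-L6-t4's `LGPFrobenioidName`, at the model: objects of
`(†𝓕⊛_MOD)_j`, `(†𝓕⊛_mod)_j`, `(†𝓕⊛_𝔪𝔬𝔡)_j` = the Example 3.6 (ii) model objects `ModelFrakObj F` (the three Frobenioids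
being IDENTIFIED along the natural isomorphisms of Prop. 3.7 (i)(ii), as the text does: "We shall often use
this isomorphism of Frobenioids to identify", p. 110 l. 22; Rmk. 3.6.2 (ii)); objects of `†𝒞^⊩_LGP`, `†𝒞^⊩_lgp` =
lgp-divisors (abc-iut-c312-3). [claim: Mochizuki2012, status: disputed] -/
def frakModelObjects : LGPFrobenioidName X.lstar → Type
  | .MOD _ => ModelFrakObj F
  | .smallMod _ => ModelFrakObj F
  | .frak _ => ModelFrakObj F
  | .CLGP => LgpDivisor F X.lstar
  | .Clgp => LgpDivisor F X.lstar

/-- **The output signature of [IUTchIII] Prop. 3.7 at the model of `𝓕⊛_𝔪𝔬𝔡`**, for an lgp object-forming map `obj`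
and a `𝔪𝔬𝔡` object-forming map `objFrak` (Prop. 3.7 (v)): Frobenioids = abc-iut-L6-t4's names with the objects
`frakModelObjects X`, isomorphisms of Frobenioids (i)(ii)(v) = the identity on the identified objects, strips =
names with singleton isomorphism types (so the full poly-isomorphisms of Def. 3.8 (ii) carry no data),
realification = the identity ON OBJECT CLASSES (model `Γ_v = ℝ`), and the realified product EMBEDDINGS of (v) =
`ofLgpDivisor` (injective, not the identity). [claim: Mochizuki2012, status: disputed] -/
def frakSignature
    (obj : (∀ v (_ : v ∈ X.S), Fin X.lstar → (v.adicCompletion F)ˣ) → LgpDivisor F X.lstar)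
    (objFrak : (∀ v (_ : v ∈ X.S), Fin X.lstar → (v.adicCompletion F)ˣ) → Fin X.lstar → ModelFrakObj F) :
    GlobalLGPFrobenioidSignature X.lstar (HeightOneSpectrum (𝓞 F)) (· ∈ X.S) (LGPFrobenioidName X.lstar)
      (fun A B => frakModelObjects X A ≃ frakModelObjects X B) (frakModelObjects X) id LGPStripName
      (fun _ _ => Unit) (fun v (_ : v ∈ X.S) => Fin X.lstar → (v.adicCompletion F)ˣ) where
  FMOD := .MOD
  Fmod := .smallMod
  Ffrak := .frak
  isoModMOD _ := Equiv.refl _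
  isoModFrak _ := Equiv.refl _
  isoFrakMOD _ := Equiv.refl _
  CLGP := .CLGP
  Clgp := .Clgp
  FLGP := .LGP
  Flgp := .lgp
  Fgau := .gau
  isoGauLGP := ()
  isoLGPlgp := ()
  isoCLGPlgp := Equiv.refl _
  embLGP := ofLgpDivisor
  embLgp := ofLgpDivisor
  embLGP_injective := ofLgpDivisor_injective
  embLgp_injective := ofLgpDivisor_injective
  objOfLgp := obj
  objOfLGP := obj
  objOfFrak := objFrak
  objOfMOD := objFrak

/-- The signature of Prop. 3.7 at the model of `𝓕⊛_𝔪𝔬𝔡` in the printed ROOT convention: lgp object-forming map =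
abc-iut-L6-t4's `thetaObjOfRoot X`, `𝔪𝔬𝔡` object-forming map = `objOfFrakModel X`.
[claim: Mochizuki2012, status: disputed] -/
def frakSignatureRoot := frakSignature X (thetaObjOfRoot X) (objOfFrakModel X)

/-- In `frakSignatureRoot X` the square of Prop. 3.7 (v) COMMUTES on objects: `embLgp ∘ objOfLgp = objOfFrak`.
[claim: Mochizuki2012, status: disputed] -/
theorem frakSignatureRoot_square (g : ∀ v ∈ X.S, Fin X.lstar → (v.adicCompletion F)ˣ) :
    (frakSignatureRoot X).embLgp ((frakSignatureRoot X).objOfLgp g) = (frakSignatureRoot X).objOfFrak g :=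
  square_objOfFrakModel X g

/-- … and likewise on the LGP/`MOD` side (the vertical isomorphisms of (v) being the identity on the identified
objects). [claim: Mochizuki2012, status: disputed] -/
theorem frakSignatureRoot_square_MOD (g : ∀ v ∈ X.S, Fin X.lstar → (v.adicCompletion F)ˣ) :
    (frakSignatureRoot X).embLGP ((frakSignatureRoot X).objOfLGP g) = (frakSignatureRoot X).objOfMOD g :=
  square_objOfFrakModel X g

variable (τ : ∀ v ∈ X.S, (v.adicCompletion F)ˣ)
  (hτ : ∀ v (hv : v ∈ X.S), ‖(τ v hv : v.adicCompletion F)‖ < 1 ∧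
    tateJ (τ v hv : v.adicCompletion F) = (X.jE : v.adicCompletion F))
  (ρ : ∀ v ∈ X.S, (v.adicCompletion F)ˣ) (hρ : ∀ v (hv : v ∈ X.S), ρ v hv ^ (2 * X.l) = τ v hv)
  (ζ : ∀ v ∈ X.S, Fin X.lstar → ((v.adicCompletion F)ˣ)ˣ)
  (hζ : ∀ v (hv : v ∈ X.S) (i : Fin X.lstar), ζ v hv i ∈ rootsOfUnity (2 * X.l) ((v.adicCompletion F)ˣ))

include hτ hρ hζ in
/-- **The Θ-pilot object of Def. 3.8 (i) IS the theta-pilot lgp-divisor `P_Θ`** for `frakSignatureRoot X` and the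
printed splitting monoids `μ_{2l}^{diag}·(ζ_j q̲_v^{j²})_j^ℕ` (`SplittingMonoids.dhRoot`; abc-iut-L6-t4's
`thetaPilotObject_eq_of_factors_root` with `Φ = id`). [claim: Mochizuki2012, status: disputed] -/
theorem thetaPilotObject_frakSignatureRoot :
    thetaPilotObject (frakSignatureRoot X) (SplittingMonoids.dhRoot X ρ ζ) = X.thetaPilot :=
  thetaPilotObject_eq_of_factors_root X τ hτ ρ hρ ζ hζ (frakSignatureRoot X) id (fun _ => rfl)

include hτ hρ hζ in
/-- `thetaPilotObject_wellDefined` ("determined by ANY collection … of generators up to torsion", Def. 3.8 (i)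
p. 112) HOLDS for `frakSignatureRoot X`. [claim: Mochizuki2012, status: disputed] -/
theorem thetaPilotObject_wellDefined_frakSignatureRoot :
    thetaPilotObject_wellDefined (frakSignatureRoot X) (SplittingMonoids.dhRoot X ρ ζ) :=
  thetaPilotObject_wellDefined_of_factors_root X τ hτ ρ hρ ζ hζ (frakSignatureRoot X) id (fun _ => rfl)

/-- **The Θ-pilot ideals** `(𝔮̲_v^{j²})_{v ∈ 𝕍^bad}`, `j ∈ 𝔽_l^⋇`, as exponent families: `Σ_{v ∈ 𝕍^bad} j²·ord_v(q̲_v)·[v]`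
(`ρ_v = q̲_v` a `2l`-th root of the Tate parameter; INTEGER exponents). [claim: Mochizuki2012, status: disputed] -/
def thetaPilotExponents (i : Fin X.lstar) : HeightOneSpectrum (𝓞 F) →₀ ℤ :=
  ∑ v ∈ X.S.attach, Finsupp.single v.1 (((labelNat i ^ 2 : ℕ) : ℤ) * CompletionModel.ordv F v.1 (ρ v.1 v.2))

/-- **The Θ-pilot object as an object of `Π_j (†𝓕⊛_𝔪𝔬𝔡)_j`** at the model of record: the family of local fractional
ideals `𝔮̲_v^{j²}` at `v ∈ 𝕍^bad`, trivial elsewhere. [claim: Mochizuki2012, status: disputed] -/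
def thetaPilotFrakModel (i : Fin X.lstar) : ModelFrakObj F :=
  ofFinDivisorFrak (realifyExponents (thetaPilotExponents X ρ i))

include hτ hρ in
/-- **The realification of the Θ-pilot ideal `𝔮̲^{j²}` is abc-iut-c312-3's theta-pilot divisor `P_{Θ,j}`**
(`P_{Θ,j}(v) = j²·ord_v(q_v)/2l = j²·ord_v(q̲_v)`). [claim: Mochizuki2012, status: disputed] -/
theorem realifyExponents_thetaPilotExponents (i : Fin X.lstar) :
    realifyExponents (thetaPilotExponents X ρ i) = X.thetaPilot i := by
  unfold thetaPilotExponents PilotData.thetaPilot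
  rw [map_sum]
  simp only [realifyExponents_single]
  refine sum_attach_of_eq X
    (c := fun v hv => ((((labelNat i ^ 2 : ℕ) : ℤ) * CompletionModel.ordv F v (ρ v hv) : ℤ) : ℝ))
    (d := fun v => (((i : ℕ) + 1 : ℝ) ^ 2) * (X.ordq v : ℝ) / (2 * X.l)) fun v hv => ?_
  rw [Int.cast_mul, Int.cast_natCast, ordv_root_real X τ hτ ρ hρ v hv]
  simp only [labelNat]
  push_cast
  ring

include hτ hρ in
/-- The realified product embedding sends the theta-pilot lgp-divisor `P_Θ` to the Θ-pilot ideal family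
`(𝔮̲_v^{j²})`. [claim: Mochizuki2012, status: disputed] -/
theorem ofLgpDivisor_thetaPilot : ofLgpDivisor X.thetaPilot = thetaPilotFrakModel X ρ := by
  funext j
  change ofFinDivisorFrak _ = ofFinDivisorFrak _
  rw [realifyExponents_thetaPilotExponents X τ hτ ρ hρ]

include hτ hρ hζ in
/-- **The `Π_j (†𝓕⊛_𝔪𝔬𝔡)_j`-incarnation of the Θ-pilot object of Def. 3.8 (i)** for `frakSignatureRoot X` and the printed
splitting monoids IS the ideal family `(𝔮̲_v^{j²})_{v ∈ 𝕍^bad, j}` — whatever generators up to torsion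
`thetaPilotObjectFrak` chooses. [claim: Mochizuki2012, status: disputed] -/
theorem thetaPilotObjectFrak_frakSignatureRoot :
    thetaPilotObjectFrak (frakSignatureRoot X) (SplittingMonoids.dhRoot X ρ ζ) = thetaPilotFrakModel X ρ := by
  unfold thetaPilotObjectFrak
  change objOfFrakModel X _ = _
  rw [← square_objOfFrakModel, ← ofLgpDivisor_thetaPilot X τ hτ ρ hρ,
    thetaObjOfRoot_eq_thetaPilot X τ hτ ρ hρ ζ hζ]
  exact fun v h => Classical.choose_spec ((SplittingMonoids.dhRoot X ρ ζ).exists_gen v h)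

include hτ hρ hζ in
/-- **Well-definedness at the `ℤ`-level**: for EVERY collection `g` of generators up to torsion of the printed
splitting monoids, the exponent families of the local fractional ideals generated by `g` are those of
`(𝔮̲_v^{j²})` — an equality of honest `ℤ`-divisors (fractional ideals), not only of their realifications.
[claim: Mochizuki2012, status: disputed] -/
theorem idealExponents_eq_thetaPilotExponents
    (g : ∀ v (h : v ∈ X.S), ↥((SplittingMonoids.dhRoot X ρ ζ).Msplit v h))
    (hg : ∀ v h, IsGeneratorUpToTorsion (g v h)) (i : Fin X.lstar) :
    idealExponents X (fun v h => (g v h : Fin X.lstar → (v.adicCompletion F)ˣ)) i = thetaPilotExponents X ρ i := by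
  apply realifyExponents_injective
  rw [realifyExponents_idealExponents, realifyExponents_thetaPilotExponents X τ hτ ρ hρ,
    thetaObjOfRoot_eq_thetaPilot X τ hτ ρ hρ ζ hζ g hg]

include hτ hρ in
/-- The Θ-pilot exponents are NONNEGATIVE (`ord_v(q̲_v) > 0`): `𝔮̲_v^{j²}` is an INTEGRAL ideal.
[claim: Mochizuki2012, status: disputed] -/
theorem thetaPilotExponents_nonneg (i : Fin X.lstar) : 0 ≤ thetaPilotExponents X ρ i := by
  unfold thetaPilotExponents
  refine Finset.sum_nonneg fun v _ => Finsupp.single_nonneg.mpr ?_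
  have h2l : (0 : ℤ) < (2 * X.l : ℕ) := by exact_mod_cast twoL_pos X
  have hq : (0 : ℤ) < (2 * X.l : ℕ) * CompletionModel.ordv F v.1 (ρ v.1 v.2) := by
    rw [ordv_root X τ hτ ρ hρ v.1 v.2]
    exact X.ordq_pos v.2
  exact mul_nonneg (Int.natCast_nonneg _) (pos_of_mul_pos_right hq h2l.le).le

include hτ hρ in
/-- **The Θ-pilot object is EFFECTIVE**: an element of abc-iut-L6-t6's divisor monoid `effDiv` of the model
Frobenioid of `𝓕⊛_𝔪𝔬𝔡` (all classes in `Γ_v^{≥0}`). [claim: Mochizuki2012, status: disputed] -/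
theorem thetaPilotFrakModel_mem_effDiv (i : Fin X.lstar) :
    thetaPilotFrakModel X ρ i ∈ effDiv (ModelPlaces F) (fun _ => ℝ) nonnegModel := by
  rw [mem_effDiv]
  rintro (w | v)
  · change (0 : ℝ) ≤ (realifyExponents (thetaPilotExponents X ρ i)) w
    rw [realifyExponents_apply]
    exact_mod_cast Finsupp.le_def.mp (thetaPilotExponents_nonneg X τ hτ ρ hρ i) w
  · exact le_refl (0 : ℝ)

include hτ hρ in
/-- The arithmetic divisor (abc-iut-L6-d3: divisor of the line bundle determined by the ideal) of the `j`-th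
Θ-pilot ideal is `−P_{Θ,j}` extended by zero. [claim: Mochizuki2012, status: disputed] -/
theorem frakDivisor_thetaPilotFrakModel (i : Fin X.lstar) :
    frakDivisor (thetaPilotFrakModel X ρ i) = -ADivisor.ofFinDivisor F (X.thetaPilot i) := by
  rw [thetaPilotFrakModel, realifyExponents_thetaPilotExponents X τ hτ ρ hρ]
  exact frakDivisor_ofFinDivisorFrak _

include hτ hρ in
/-- **Degree of the Θ-pilot ideals**: `deg(𝔮̲^{j²}) = −deĝ_F(P_{Θ,j})` (abc-iut-c312-3's theta-pilot divisor).
[claim: Mochizuki2012, status: disputed] -/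
theorem frakDeg_thetaPilotFrakModel (i : Fin X.lstar) :
    frakDeg (thetaPilotFrakModel X ρ i) = -FinDivisor.deg F (X.thetaPilot i) := by
  rw [thetaPilotFrakModel, realifyExponents_thetaPilotExponents X τ hτ ρ hρ]
  exact frakDeg_ofFinDivisorFrak _

include hτ hρ in
/-- The Θ-pilot ideals have NEGATIVE degree (`deĝ_F(P_{Θ,j}) = j²·deĝ_F(P_q) > 0`).
[claim: Mochizuki2012, status: disputed] -/
theorem frakDeg_thetaPilotFrakModel_neg (i : Fin X.lstar) : frakDeg (thetaPilotFrakModel X ρ i) < 0 := by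
  rw [frakDeg_thetaPilotFrakModel X τ hτ ρ hρ, neg_lt_zero, PilotData.deg_thetaPilot]
  exact mul_pos (by positivity) X.deg_qPilot_pos

include hτ hρ in
/-- **[IUTchIII] Prop. 3.9 (iii) for the Θ-pilot object**: the global log-volume of the `j`-th component of the
Θ-pilot object of `Π_j (†𝓕⊛_𝔪𝔬𝔡)_j` is `−deĝ_F(P_{Θ,j})` ("the global log-volume … is equal to the degree of the
arithmetic line bundle determined by `𝔍`", through abc-iut-L6-d3's `globalLogVolume_frakRegion`).
[claim: Mochizuki2012, status: disputed] -/
theorem globalLogVolume_thetaPilotFrakModel (i : Fin X.lstar) :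
    globalLogVolume (divisorLogVolume F) (frakRegion (thetaPilotFrakModel X ρ i)) =
      -FinDivisor.deg F (X.thetaPilot i) := by
  rw [globalLogVolume_frakRegion, frakDeg_thetaPilotFrakModel X τ hτ ρ hρ]

include hτ hρ in
/-- **Procession average**: the average over `j ∈ 𝔽_l^⋇` of the degrees of the Θ-pilot ideals is
`−deĝ_lgp(P_Θ) = −((l⋆+1)(2l⋆+1)/6)·deĝ_F(P_q)` (abc-iut-c312-3's `degLgp_thetaPilot`; the coefficient of [IUTchIV]
Thm. 1.10, Step (v)). [claim: Mochizuki2012, status: disputed] -/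
theorem avg_frakDeg_thetaPilotFrakModel :
    (1 / (X.lstar : ℝ)) * ∑ i, frakDeg (thetaPilotFrakModel X ρ i) =
      -((((X.lstar : ℝ) + 1) * (2 * X.lstar + 1) / 6) * FinDivisor.deg F X.qPilot) := by
  rw [← PilotData.degLgp_thetaPilot, LgpDivisor.degLgp, ← mul_neg, ← Finset.sum_neg_distrib]
  congr 1
  exact Finset.sum_congr rfl fun i _ => frakDeg_thetaPilotFrakModel X τ hτ ρ hρ i

end Signature


end Literature.IUT.LogThetaLattice
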